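import Literature.RingTheory.FormalGroups.FormalGroupHeight
import HarnessLib

/-!
# Base change of sums of homomorphisms, of the `[n]`-series and of heights
# ([Hazewinkel 1978] §1.1 (1.1.6), §18.3; P6d letter 3b-ht «residual height is read off the reduction»)

Topic `Literature/RingTheory/FormalGroups`; namespace `Literature.RingTheory.FormalGroups`.  THEOREMS ONLY (no definition, no named
fact, no instance, no notation, no `sorry`).  Cell `hodgecm-mathlib`, P6 «MOD programme» ROW 4B: the c𝒪 ∕ 3b-ht provers compare a law
`F′` over `A′` with its reduction `F′.map π` over `A = A′⧸I`; this file says that `[n]`, sums of homomorphisms and the two ★ height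
predicates (`IsOfPHeight`, `FormalOModuleLaw.IsOfHeight`) are COMPATIBLE WITH BASE CHANGE along any ring map `f : A →+* B` (resp.
`𝒪`-algebra map).  Over: Mathlib `FormalGroup.map`, ★ `FormalGroupHom.map` (p844377), ★ `FormalGroupHom.add`∕`nsmulHom` (p844435),
★ `FormalOModuleLaw.map` (p844456), ★ `IsOfPHeight` (p844583).

## Contents

* `FormalGroupHom.map_zero_hom`, `FormalGroupHom.map_add_hom` (`f_*(φ + ψ) = f_*φ + f_*ψ`), **`FormalGroupHom.map_nsmulHom`**
  (`f_*[n]_F = [n]_{f_*F}`), `coeff_nsmulHom_map` (coefficients of `[n]_{f_* F}` are the images of those of `[n]_F`).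
* **`IsOfPHeight.map`** (`p`-height is preserved by base change) and **`FormalOModuleLaw.IsOfHeight.map`** (`𝒪`-height likewise).
-/

noncomputable section

namespace Literature.RingTheory.FormalGroups

open _root_.MvPowerSeries (HasSubst subst)

universe u v w

variable {A : Type u} [CommRing A] {B : Type v} [CommRing B]

namespace FormalGroupHom

variable {F G : FormalGroup A}

/-- Base change of the zero homomorphism is the zero homomorphism. [cite: Hazewinkel1978, §1.1 (1.1.6)] -/
theorem map_zero_hom (f : A →+* B) : (FormalGroupHom.zero F G).map f = FormalGroupHom.zero (F.map f) (G.map f) := by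
  ext1; simp

/-- **Base change is additive on homomorphisms**: `f_*(φ + ψ) = f_*φ + f_*ψ` (into a commutative law; `f_* G` is commutative by
★ `isComm_map`). [cite: Hazewinkel1978, §1.1 (1.1.6)] -/
theorem map_add_hom [G.IsComm] (f : A →+* B) (φ ψ : FormalGroupHom F G) :
    (φ.add ψ).map f = (haveI := isComm_map G f; (φ.map f).add (ψ.map f)) := by
  haveI := isComm_map G f
  ext1
  have hvec : (fun i => MvPowerSeries.map f ((![φ.toPowerSeries, ψ.toPowerSeries] : Fin 2 → PowerSeries A) i)) =
      ![PowerSeries.map f φ.toPowerSeries, PowerSeries.map f ψ.toPowerSeries] := by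
    funext i; fin_cases i <;> rfl
  rw [map_toPowerSeries, add_toPowerSeries, add_toPowerSeries, map_toPowerSeries, map_toPowerSeries, FormalGroup.map_toPowerSeries]
  change MvPowerSeries.map f _ = _
  rw [MvPowerSeries.map_subst (hasSubst_pair φ.hasSubst ψ.hasSubst), hvec]

/-- **`f_*[n]_F = [n]_{f_*F}`**: the `[n]`-series commutes with base change. [cite: Hazewinkel1978, §1.1 (1.1.6)] -/
theorem map_nsmulHom [F.IsComm] (f : A →+* B) (n : ℕ) :
    (nsmulHom F n).map f = (haveI := isComm_map F f; nsmulHom (F.map f) n) := by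
  haveI := isComm_map F f
  induction n with
  | zero => rw [nsmulHom_zero, nsmulHom_zero, map_zero_hom]
  | succ n ih => rw [nsmulHom_succ, nsmulHom_succ, map_add_hom, ih, map_id]

/-- The coefficients of `[n]_{f_*F}` are the images under `f` of those of `[n]_F`. [cite: Hazewinkel1978, §1.1 (1.1.6)] -/
theorem coeff_nsmulHom_map [F.IsComm] (f : A →+* B) (n i : ℕ) :
    PowerSeries.coeff i (haveI := isComm_map F f; nsmulHom (F.map f) n).toPowerSeries =
      f (PowerSeries.coeff i (nsmulHom F n).toPowerSeries) := by
  rw [← map_nsmulHom, map_toPowerSeries, PowerSeries.coeff_map]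

end FormalGroupHom

/-- The height normal form is preserved by base change: `f_*(u(X^k)) = (f_* u)(X^k)`, `(f_* u)(0) = 0`, `(f_* u)₁ = f(u₁)` a unit.
[cite: Hazewinkel1978, §18.3] -/
theorem exists_normalForm_map (f : A →+* B) {s u : PowerSeries A} (hu0 : PowerSeries.constantCoeff u = 0)
    (hu1 : IsUnit (PowerSeries.coeff 1 u)) {k : ℕ} (hk : k ≠ 0)
    (hs : s = PowerSeries.subst ((PowerSeries.X : PowerSeries A) ^ k) u) :
    ∃ u' : PowerSeries B, PowerSeries.constantCoeff u' = 0 ∧ IsUnit (PowerSeries.coeff 1 u') ∧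
      PowerSeries.map f s = PowerSeries.subst ((PowerSeries.X : PowerSeries B) ^ k) u' := by
  refine ⟨PowerSeries.map f u, ?_, ?_, ?_⟩
  · rw [← PowerSeries.coeff_zero_eq_constantCoeff_apply, PowerSeries.coeff_map, PowerSeries.coeff_zero_eq_constantCoeff_apply, hu0,
      map_zero]
  · rw [PowerSeries.coeff_map]; exact hu1.map f
  · rw [hs]
    change MvPowerSeries.map f _ = _
    rw [PowerSeries.map_subst (PowerSeries.HasSubst.X_pow hk)]
    change PowerSeries.subst (PowerSeries.map f (PowerSeries.X ^ k)) (PowerSeries.map f u) = _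
    rw [map_pow, PowerSeries.map_X]

/-- **`p`-height is preserved by base change**: `IsOfPHeight F p h → IsOfPHeight (f_* F) p h`. [cite: Hazewinkel1978, §18.3] -/
theorem IsOfPHeight.map {F : FormalGroup A} [F.IsComm] {p h : ℕ} (hF : IsOfPHeight F p h) (hph : p ^ h ≠ 0) (f : A →+* B) :
    haveI := isComm_map F f; IsOfPHeight (F.map f) p h := by
  haveI := isComm_map F f
  obtain ⟨u, hu0, hu1, hu⟩ := hF
  obtain ⟨u', h0, h1, h⟩ := exists_normalForm_map f hu0 hu1 hph hu
  refine ⟨u', h0, h1, ?_⟩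
  rw [← FormalGroupHom.map_nsmulHom, FormalGroupHom.map_toPowerSeries, h]

/-- **`𝒪`-height is preserved by base change** along an `𝒪`-algebra map. [cite: Hazewinkel1978, §21.1 (21.1.4)] -/
theorem FormalOModuleLaw.IsOfHeight.map {𝒪 : Type w} [CommRing 𝒪] [Algebra 𝒪 A] [Algebra 𝒪 B] {M : FormalOModuleLaw 𝒪 A}
    {π : 𝒪} {q h : ℕ} (hM : M.IsOfHeight π q h) (hqh : q ^ h ≠ 0) (f : A →ₐ[𝒪] B) : (M.map f).IsOfHeight π q h := by
  obtain ⟨u, hu0, hu1, hu⟩ := hM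
  obtain ⟨u', h0, h1, h⟩ := exists_normalForm_map f.toRingHom hu0 hu1 hqh hu
  exact ⟨u', h0, h1, by rw [FormalOModuleLaw.map_act, FormalGroupHom.map_toPowerSeries, h]⟩

end Literature.RingTheory.FormalGroups
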